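import Mathlib.Data.Real.Basic
import Mathlib.Data.Fintype.Fin
import Mathlib.Tactic.Linarith

/-!
# Wall bubbling for `DoorA26` — TWO WEYL PAIRS ON A WALL: the additive relations of the wall strata (c1)/(c2) (pure arithmetic)

HONEST FRAMING.  Bookkeeping for obligation (W) `stub_weylFaces` of `Cruxes/DoorA26/Lines/wall_bubbling.lean` (crux `DoorA26`,
stmt-ValiantsHypothesis-19979; OPEN, typed, never asserted), stratum `Stmt.weylFaces_wall` of `Cruxes/DoorA26/Lines/wall_bubbling_ConfluentDoor.lean`
rev 5d, TWO Weyl pairs (four distinct values `f 0, …, f 3`; `f 0`, `f 1` the pairs' values).  W1 seat val-sym-door-p2 g13 (#43a), companion of W1 #42a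
`…OnePairWallRelations`.  Among four distinct reals without three-term relations, a disjoint relation in normal position (c1) `f 0 + f 1 = f 2 + f 3`,
resp. (c2) `f 0 + f 2 = f 1 + f 3`, is the only non-trivial additive relation `f a + f b = f c + f e` — exactly the genericity hypothesis `hgen` of
W1 #26d/#26b (`…DoublyConfluentNondegWallC1/C2`) and #28; (c3) `f 0 + f 3 = f 1 + f 2` is (c2) after swapping the positions `2, 3` and is not needed by
W1 #43 `…WallStratumReduction`.  Proof: index patterns with a repetition die by injectivity / the three-term exclusion; the 24 patterns with four
distinct indices are enumerated, each non-normal one dying by a coincidence or a three-term relation read off from `h ± hR` (`linarith`).  Def-free.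
Registers unchanged; (W), `DoorA26` 19979, 18050 OPEN; nothing on VP ≠ VNP.  `--supports stmt-ValiantsHypothesis-19979 --as helper`.
-/

-- `Summit.ValiantsHypothesis.ValiantsHypothesis.…` repeats a component by the D-0017 layout
-- (single-conjunct summit), which the `dupNamespace` linter flags; the name is mandated.
set_option linter.dupNamespace false

namespace Summit.ValiantsHypothesis.ValiantsHypothesis.Theorems.LacunarySymmetroidMatrixDescartes.WallBubbling

/-- **The additive relations on the two-pair wall (c1)** `f 0 + f 1 = f 2 + f 3`: among four distinct reals without three-term relation `2x = y + z` it is the only non-trivial additive relation. [this work] -/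
theorem relClass_twoPairWallC1 (f : Fin 4 → ℝ) (hinj : ∀ a b : Fin 4, f a = f b → a = b)
    (hnoAP : ∀ x y z : Fin 4, x ≠ y → x ≠ z → y ≠ z → 2 * f x ≠ f y + f z)
    (hR : f 0 + f 1 = f 2 + f 3) :
    ∀ a b c e : Fin 4, f a + f b = f c + f e →
      (a = c ∧ b = e) ∨ (a = e ∧ b = c) ∨
        (((a = 0 ∧ b = 1) ∨ (a = 1 ∧ b = 0)) ∧ ((c = 2 ∧ e = 3) ∨ (c = 3 ∧ e = 2))) ∨
        (((a = 2 ∧ b = 3) ∨ (a = 3 ∧ b = 2)) ∧ ((c = 0 ∧ e = 1) ∨ (c = 1 ∧ e = 0))) := by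
  intro a b c e h
  by_cases hac : a = c
  · subst hac; exact Or.inl ⟨rfl, hinj _ _ (by linarith)⟩
  by_cases hae : a = e
  · subst hae; exact Or.inr (Or.inl ⟨rfl, hinj _ _ (by linarith)⟩)
  by_cases hbc : b = c
  · subst hbc; exact absurd (hinj a e (by linarith)) hae
  by_cases hbe : b = e
  · subst hbe; exact absurd (hinj a c (by linarith)) hac
  by_cases hab : a = b
  · subst hab
    have hce : c ≠ e := fun hce => by subst hce; exact hac (hinj _ _ (by linarith))
    exact absurd (by linarith : 2 * f a = f c + f e) (hnoAP a c e hac hae hce)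
  by_cases hce : c = e
  · subst hce
    exact absurd (by linarith : 2 * f c = f a + f b) (hnoAP c a b (Ne.symm hac) (Ne.symm hbc) hab)
  have h4 : ∀ x : Fin 4, x = 0 ∨ x = 1 ∨ x = 2 ∨ x = 3 := by decide
  rcases h4 a with rfl | rfl | rfl | rfl <;> rcases h4 b with rfl | rfl | rfl | rfl <;>
    rcases h4 c with rfl | rfl | rfl | rfl <;> rcases h4 e with rfl | rfl | rfl | rfl
  any_goals exact absurd rfl hab
  any_goals exact absurd rfl hac
  any_goals exact absurd rfl hae
  any_goals exact absurd rfl hbc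
  any_goals exact absurd rfl hbe
  any_goals exact absurd rfl hce
  · exact Or.inr (Or.inr (Or.inl ⟨Or.inl ⟨rfl, rfl⟩, Or.inl ⟨rfl, rfl⟩⟩))
  · exact Or.inr (Or.inr (Or.inl ⟨Or.inl ⟨rfl, rfl⟩, Or.inr ⟨rfl, rfl⟩⟩))
  · exact absurd (hinj 1 2 (by linarith)) (by decide)
  · exact absurd (hinj 1 2 (by linarith)) (by decide)
  · exact absurd (hinj 1 3 (by linarith)) (by decide)
  · exact absurd (hinj 1 3 (by linarith)) (by decide)
  · exact Or.inr (Or.inr (Or.inl ⟨Or.inr ⟨rfl, rfl⟩, Or.inl ⟨rfl, rfl⟩⟩))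
  · exact Or.inr (Or.inr (Or.inl ⟨Or.inr ⟨rfl, rfl⟩, Or.inr ⟨rfl, rfl⟩⟩))
  · exact absurd (hinj 0 2 (by linarith)) (by decide)
  · exact absurd (hinj 0 2 (by linarith)) (by decide)
  · exact absurd (hinj 0 3 (by linarith)) (by decide)
  · exact absurd (hinj 0 3 (by linarith)) (by decide)
  · exact absurd (hinj 1 2 (by linarith)) (by decide)
  · exact absurd (hinj 1 2 (by linarith)) (by decide)
  · exact absurd (hinj 0 2 (by linarith)) (by decide)
  · exact absurd (hinj 0 2 (by linarith)) (by decide)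
  · exact Or.inr (Or.inr (Or.inr ⟨Or.inl ⟨rfl, rfl⟩, Or.inl ⟨rfl, rfl⟩⟩))
  · exact Or.inr (Or.inr (Or.inr ⟨Or.inl ⟨rfl, rfl⟩, Or.inr ⟨rfl, rfl⟩⟩))
  · exact absurd (hinj 1 3 (by linarith)) (by decide)
  · exact absurd (hinj 1 3 (by linarith)) (by decide)
  · exact absurd (hinj 0 3 (by linarith)) (by decide)
  · exact absurd (hinj 0 3 (by linarith)) (by decide)
  · exact Or.inr (Or.inr (Or.inr ⟨Or.inr ⟨rfl, rfl⟩, Or.inl ⟨rfl, rfl⟩⟩))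
  · exact Or.inr (Or.inr (Or.inr ⟨Or.inr ⟨rfl, rfl⟩, Or.inr ⟨rfl, rfl⟩⟩))

/-- **The additive relations on the two-pair wall (c2)** `f 0 + f 2 = f 1 + f 3`: the same. [this work] -/
theorem relClass_twoPairWallC2 (f : Fin 4 → ℝ) (hinj : ∀ a b : Fin 4, f a = f b → a = b)
    (hnoAP : ∀ x y z : Fin 4, x ≠ y → x ≠ z → y ≠ z → 2 * f x ≠ f y + f z)
    (hR : f 0 + f 2 = f 1 + f 3) :
    ∀ a b c e : Fin 4, f a + f b = f c + f e →
      (a = c ∧ b = e) ∨ (a = e ∧ b = c) ∨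
        (((a = 0 ∧ b = 2) ∨ (a = 2 ∧ b = 0)) ∧ ((c = 1 ∧ e = 3) ∨ (c = 3 ∧ e = 1))) ∨
        (((a = 1 ∧ b = 3) ∨ (a = 3 ∧ b = 1)) ∧ ((c = 0 ∧ e = 2) ∨ (c = 2 ∧ e = 0))) := by
  intro a b c e h
  by_cases hac : a = c
  · subst hac; exact Or.inl ⟨rfl, hinj _ _ (by linarith)⟩
  by_cases hae : a = e
  · subst hae; exact Or.inr (Or.inl ⟨rfl, hinj _ _ (by linarith)⟩)
  by_cases hbc : b = c
  · subst hbc; exact absurd (hinj a e (by linarith)) hae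
  by_cases hbe : b = e
  · subst hbe; exact absurd (hinj a c (by linarith)) hac
  by_cases hab : a = b
  · subst hab
    have hce : c ≠ e := fun hce => by subst hce; exact hac (hinj _ _ (by linarith))
    exact absurd (by linarith : 2 * f a = f c + f e) (hnoAP a c e hac hae hce)
  by_cases hce : c = e
  · subst hce
    exact absurd (by linarith : 2 * f c = f a + f b) (hnoAP c a b (Ne.symm hac) (Ne.symm hbc) hab)
  have h4 : ∀ x : Fin 4, x = 0 ∨ x = 1 ∨ x = 2 ∨ x = 3 := by decide
  rcases h4 a with rfl | rfl | rfl | rfl <;> rcases h4 b with rfl | rfl | rfl | rfl <;>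
    rcases h4 c with rfl | rfl | rfl | rfl <;> rcases h4 e with rfl | rfl | rfl | rfl
  any_goals exact absurd rfl hab
  any_goals exact absurd rfl hac
  any_goals exact absurd rfl hae
  any_goals exact absurd rfl hbc
  any_goals exact absurd rfl hbe
  any_goals exact absurd rfl hce
  · exact absurd (hinj 1 2 (by linarith)) (by decide)
  · exact absurd (hinj 1 2 (by linarith)) (by decide)
  · exact Or.inr (Or.inr (Or.inl ⟨Or.inl ⟨rfl, rfl⟩, Or.inl ⟨rfl, rfl⟩⟩))
  · exact Or.inr (Or.inr (Or.inl ⟨Or.inl ⟨rfl, rfl⟩, Or.inr ⟨rfl, rfl⟩⟩))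
  · exact absurd (hinj 2 3 (by linarith)) (by decide)
  · exact absurd (hinj 2 3 (by linarith)) (by decide)
  · exact absurd (hinj 1 2 (by linarith)) (by decide)
  · exact absurd (hinj 1 2 (by linarith)) (by decide)
  · exact absurd (hinj 0 1 (by linarith)) (by decide)
  · exact absurd (hinj 0 1 (by linarith)) (by decide)
  · exact Or.inr (Or.inr (Or.inr ⟨Or.inl ⟨rfl, rfl⟩, Or.inl ⟨rfl, rfl⟩⟩))
  · exact Or.inr (Or.inr (Or.inr ⟨Or.inl ⟨rfl, rfl⟩, Or.inr ⟨rfl, rfl⟩⟩))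
  · exact Or.inr (Or.inr (Or.inl ⟨Or.inr ⟨rfl, rfl⟩, Or.inl ⟨rfl, rfl⟩⟩))
  · exact Or.inr (Or.inr (Or.inl ⟨Or.inr ⟨rfl, rfl⟩, Or.inr ⟨rfl, rfl⟩⟩))
  · exact absurd (hinj 0 1 (by linarith)) (by decide)
  · exact absurd (hinj 0 1 (by linarith)) (by decide)
  · exact absurd (hinj 0 3 (by linarith)) (by decide)
  · exact absurd (hinj 0 3 (by linarith)) (by decide)
  · exact absurd (hinj 2 3 (by linarith)) (by decide)
  · exact absurd (hinj 2 3 (by linarith)) (by decide)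
  · exact Or.inr (Or.inr (Or.inr ⟨Or.inr ⟨rfl, rfl⟩, Or.inl ⟨rfl, rfl⟩⟩))
  · exact Or.inr (Or.inr (Or.inr ⟨Or.inr ⟨rfl, rfl⟩, Or.inr ⟨rfl, rfl⟩⟩))
  · exact absurd (hinj 0 3 (by linarith)) (by decide)
  · exact absurd (hinj 0 3 (by linarith)) (by decide)

end Summit.ValiantsHypothesis.ValiantsHypothesis.Theorems.LacunarySymmetroidMatrixDescartes.WallBubbling
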